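import Summits.Ventures.HodgeRepro.Tier3PinningGlue

/-!
# Tier 3, T3.2 — the ν ↔ ζ dictionary on the kernel: continuous characters of `ℤ_p` and the pinning
(seat t3-p3, gen 2)

Blind re-derivation cell `pub-hodge-repro`, Tier-3 seat `t3-p3` (route/TIER3.md v1.1 §3 row R-B, sub-residual
R-B.3 «the ν ↔ ζ dictionary», closed on paper by t3-p4 on Lang GTM 121).  On a degree-one line
`Γ_𝔭 ≅ ℤ_p` a character `ν` of `Γ_𝔭` is a continuous (additive) character `κ : ℤ_p → B` of the coordinate
`ℤ_p`, and the dictionary sends it to `ζ_ν − 1 := κ(1) − 1`.  Mathlib (`PadicInt.continuousAddCharEquiv`,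
D. Loeffler) proves that for any complete ultrametric normed `ℤ_p`-algebra `B` this is a BIJECTION between
continuous additive characters `ℤ_p → B` and topologically nilpotent elements of `B`.  This file reads off
the two halves the interpolation glue needs and composes them with `Tier3PinningGlue`:

* `injective_eval_one` — `κ ↦ κ 1` is injective on continuous characters (a character of `ℤ_p` is
  determined by its value at `1`, by density of `ℕ` in `ℤ_p`);
* `hasEval_eval_one_sub_one` — `κ 1 − 1` is topologically nilpotent, i.e. an evaluation point of power
  series (`PowerSeries.HasEval`);
* `infinite_continuousAddChar` — there are infinitely many continuous characters as soon as `B` is a domain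
  in which `p` is a non-zero non-unit topologically nilpotent element (the characters `n ↦ (1 + p^k)^n`);
* `infinite_common_good_of_padic_chars` — the pinning chain on the kernel with the dictionary DISCHARGED:
  per line `j` a branch element `G j ∈ A⟦X⟧`, the interpolation formula `L j κ = u j κ · (G j)(κ 1 − 1)` with
  non-zero factors, ONE non-vanishing value, finitely many bad signs ⇒ infinitely many continuous characters
  `κ` are good for every line at once.

HONESTY.  `hL` (the interpolation formula — the identification of the Iwasawa-algebra element with `G` and of
`∫ κ dL` with `G(κ 1 − 1)`, Lang GTM 121 / t3-p4 R-B3-DICTIONARY.md), `h0` (one non-vanishing value per line —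
TIER3.md's residual R-B) and `hε` (sign cofiniteness) are HYPOTHESES; nothing about Hecke characters or
`L`-values is proved here.  Nothing here says anything about the status of the Hodge conjecture for CM abelian
varieties, which is NOT proved.
-/

set_option autoImplicit false

namespace Summit.Ventures.HodgeRepro.T3.R2Pinning

open Filter Topology

section Dictionary

variable {p : ℕ} [Fact p.Prime]
variable {B : Type*} [NormedCommRing B] [Algebra ℤ_[p] B] [IsBoundedSMul ℤ_[p] B] [IsUltrametricDist B]
  [CompleteSpace B]

omit [Algebra ℤ_[p] B] [IsBoundedSMul ℤ_[p] B] [CompleteSpace B] in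
/-- **The dictionary is injective**: a continuous character of `ℤ_p` is determined by its value at `1`. -/
theorem injective_eval_one :
    Function.Injective (fun κ : {κ : AddChar ℤ_[p] B // Continuous κ} => (κ.1 1 : B)) := by
  rintro ⟨κ₁, h₁⟩ ⟨κ₂, h₂⟩ h
  exact Subtype.ext (PadicInt.denseRange_natCast.addChar_eq_of_eval_one_eq h₁ h₂ h)

omit [CompleteSpace B] in
/-- **The dictionary lands on evaluation points**: `κ 1 − 1` is topologically nilpotent. -/
theorem hasEval_eval_one_sub_one (κ : {κ : AddChar ℤ_[p] B // Continuous κ}) :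
    PowerSeries.HasEval (κ.1 1 - 1) :=
  κ.1.tendsto_eval_one_sub_pow κ.2

/-- **Infinitely many characters**: if `p` is a non-zero, non-unit, topologically nilpotent element of the
domain `B`, the continuous characters of `ℤ_p` with values in `B` form an infinite type (the characters with
`κ 1 = 1 + p^k`, `k ≥ 1`, are pairwise distinct). -/
theorem infinite_continuousAddChar [IsDomain B] (hp0 : (p : B) ≠ 0) (hpu : ¬ IsUnit (p : B))
    (hpt : IsTopologicallyNilpotent (p : B)) :
    Infinite {κ : AddChar ℤ_[p] B // Continuous κ} := by
  -- the topologically nilpotent elements `p ^ (k + 1)` are pairwise distinct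
  have hinj : Function.Injective fun k : ℕ => (p : B) ^ (k + 1) := by
    intro a b hab
    simp only at hab
    by_contra hne
    wlog hlt : a < b generalizing a b
    · exact this hab.symm (Ne.symm hne) (lt_of_le_of_ne (not_lt.mp hlt) (Ne.symm hne))
    have hsplit : (p : B) ^ (b + 1) = (p : B) ^ (a + 1) * (p : B) ^ (b - a) := by
      rw [← pow_add]; congr 1; omega
    have h1 : (p : B) ^ (a + 1) * (1 - (p : B) ^ (b - a)) = 0 := by
      rw [mul_sub, mul_one, ← hsplit, hab, sub_self]
    rcases mul_eq_zero.mp h1 with h | h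
    · exact hp0 (pow_eq_zero_iff'.mp h).1
    · have hpow : (p : B) ^ (b - a) = 1 := by linear_combination -h
      exact hpu (IsUnit.of_pow_eq_one hpow (by omega))
  have hnil : ∀ k : ℕ, Tendsto (((p : B) ^ (k + 1)) ^ ·) atTop (𝓝 0) := fun k => by
    have h := hpt.comp (tendsto_id.const_mul_atTop' (Nat.succ_pos k))
    refine h.congr fun x => ?_
    simp only [Function.comp_apply, id, pow_mul]
  -- transport the infinite family through Mathlib's equivalence
  let f : ℕ → {r : B // Tendsto (r ^ ·) atTop (𝓝 0)} := fun k => ⟨(p : B) ^ (k + 1), hnil k⟩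
  have hf : Function.Injective f := fun a b h => hinj (congrArg Subtype.val h)
  have : Infinite {r : B // Tendsto (r ^ ·) atTop (𝓝 0)} := Infinite.of_injective f hf
  exact Infinite.of_injective _ (PadicInt.continuousAddCharEquiv p B).symm.injective

end Dictionary

section Glue

open PowerSeries

variable {p : ℕ} [Fact p.Prime]
variable {A : Type*} [CommRing A] [IsDomain A] [IsDiscreteValuationRing A]
  [IsAdicComplete (IsLocalRing.maximalIdeal A) A] [UniformSpace A] [IsUniformAddGroup A]
  [IsTopologicalRing A]
variable {B : Type*} [NormedCommRing B] [IsDomain B] [Algebra ℤ_[p] B] [IsBoundedSMul ℤ_[p] B]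
  [IsUltrametricDist B] [CompleteSpace B] [IsLinearTopology B B] [Algebra A B] [ContinuousSMul A B]

/-- **The pinning chain with the dictionary discharged.**  `Ξ` = the continuous characters `κ` of `ℤ_p`
(`= Γ_𝔭` on a degree-one line) with values in `B`, infinitely many (`infinite_continuousAddChar`).  For each
line `j`: the branch element `G j ∈ A⟦X⟧`, the interpolation formula at the dictionary's point `κ 1 − 1` with
non-zero factors `u j κ`, ONE non-vanishing value `L j κ₀ ≠ 0`, finitely many characters of bad sign.  Then
infinitely many `κ` are good for every line. -/
theorem infinite_common_good_of_padic_chars {ι : Type*} [Finite ι]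
    (hinj : Function.Injective (algebraMap A B)) (hp0 : (p : B) ≠ 0) (hpu : ¬ IsUnit (p : B))
    (hpt : IsTopologicallyNilpotent (p : B)) (G : ι → PowerSeries A)
    (L u : ι → {κ : AddChar ℤ_[p] B // Continuous κ} → B) (hu : ∀ j κ, u j κ ≠ 0)
    (hL : ∀ j κ, L j κ = u j κ * aeval (hasEval_eval_one_sub_one κ) (G j))
    (h0 : ∀ j, ∃ κ₀, L j κ₀ ≠ 0) (ε : ι → {κ : AddChar ℤ_[p] B // Continuous κ} → ℤˣ)
    (hε : ∀ j, {κ | ε j κ ≠ 1}.Finite) :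
    {κ : {κ : AddChar ℤ_[p] B // Continuous κ} | ∀ j, L j κ ≠ 0 ∧ ε j κ = 1}.Infinite := by
  haveI : Infinite {κ : AddChar ℤ_[p] B // Continuous κ} := infinite_continuousAddChar hp0 hpu hpt
  have key := infinite_common_good_of_interpolation (A := A) (B := B)
    (Ξ := {κ : AddChar ℤ_[p] B // Continuous κ}) hinj (fun κ => κ.1 1) injective_eval_one
    hasEval_eval_one_sub_one G L u hu hL h0 ε hε
  exact key


/-- **The face with the dictionary discharged.** Four lines over the continuous characters of `ℤ_p`
(`= Γ_𝔭` on a degree-one line): the common character `κ`, and N2 for the constant vector stated on the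
characters themselves (`AddChar ℤ_[p] B` is a commutative monoid under pointwise multiplication:
`η 0 * η 1 = η 2 * η 3`). -/
theorem four_line_pinning_of_padic_chars
    (hinj : Function.Injective (algebraMap A B)) (hp0 : (p : B) ≠ 0) (hpu : ¬ IsUnit (p : B))
    (hpt : IsTopologicallyNilpotent (p : B)) (G : Fin 4 → PowerSeries A)
    (L u : Fin 4 → {κ : AddChar ℤ_[p] B // Continuous κ} → B) (hu : ∀ j κ, u j κ ≠ 0)
    (hL : ∀ j κ, L j κ = u j κ * aeval (hasEval_eval_one_sub_one κ) (G j))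
    (h0 : ∀ j, ∃ κ₀, L j κ₀ ≠ 0) (ε : Fin 4 → {κ : AddChar ℤ_[p] B // Continuous κ} → ℤˣ)
    (hε : ∀ j, {κ | ε j κ ≠ 1}.Finite) :
    {κ : {κ : AddChar ℤ_[p] B // Continuous κ} | ∀ j, L j κ ≠ 0 ∧ ε j κ = 1}.Infinite ∧
      ∀ κ ∈ {κ : {κ : AddChar ℤ_[p] B // Continuous κ} | ∀ j, L j κ ≠ 0 ∧ ε j κ = 1},
        ∀ η : Fin 4 → {κ : AddChar ℤ_[p] B // Continuous κ}, (∀ j, η j = κ) →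
          (η 0).1 * (η 1).1 = (η 2).1 * (η 3).1 :=
  ⟨infinite_common_good_of_padic_chars hinj hp0 hpu hpt G L u hu hL h0 ε hε,
    fun κ _ η hη => by rw [hη 0, hη 1, hη 2, hη 3]⟩

end Glue

end Summit.Ventures.HodgeRepro.T3.R2Pinning
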